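import Summits.ResolutionOfSingularities.ResolutionOfSingularities.Theorems.RadicialJungCleanModelsCcurvePersistOne
import Summits.ResolutionOfSingularities.ResolutionOfSingularities.Theorems.RadicialJungCleanModelsCcurvePersistForm3
import HarnessLib

/-!
# [GENERAL-FIELD VERSION `persistForm3_gen_of` (lead g7, towards Sketch rev 30): the `[PerfectField k]` binder of the original is REMOVED; the proof is unchanged.]
# Route `RadicialJung`, crux `CleanModels` (stmt-15917) — (C-curve) sub-line: `stub_Cc_persistForm3` modulo the shared stub `stub_Cc_centreCurve` only

Lead `res-B-lead-1` g7 (plan `Cruxes/CleanModels/Lines/Sketch-memo-Ccurve-plan.md` §1 S5b; workfile `Lines/Sketch_Ccurve_assembly.lean` v2.8 stub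
`Ccurve.stub_Cc_persistForm3`).  OURS · counted 0.  Nothing here proves resolution in characteristic `p`; resolution in char `p` is NOT proved.

`persistForm3_of`: the statement of `stub_Cc_persistForm3` (closed-point persist, FORM (3) at the local ring of the centre curve: `G − c′^p = τ ∈ 𝔪₁ ∖ 𝔪₁²`)
from ONE hypothesis stated as a closed proposition: (hS3) the shared stub `stub_Cc_centreCurve` VERBATIM (a node of the workfile since v2.7).
Route: S3 ⇒ r.s.p. `(x, y, z)` of `S' = locAtCentre B′ O`, `(x, y)` the centre of `O₁`, `locAtCentre · O₁` unchanged; `τ = (x α + y β)/γ` (✓ `exists_numerator_of_valuation_lt`)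
with `(α, β) ∉ (x, y) × (x, y)` (✓ `transversal_of_not_mem_sq`, from `τ ∉ 𝔪₁²`); the `K^p`-rescaling `c ↦ (c − [j = 0] c′) · γ` turns the representative into
`γ^{p-1} · (x α + y β)` and ✓ `persist_one_core` (point blow-ups along `O`, exponent of `z` reduced mod `p`) gives loose-clean FORM (1) upstairs — never form (3).
-/

noncomputable section

set_option linter.dupNamespace false

open IsLocalRing Literature.AlgebraicGeometry.Resolution
open Summit.ResolutionOfSingularities.ResolutionOfSingularities.Theorems

namespace Summit.ResolutionOfSingularities.ResolutionOfSingularities.Theorems.RadicialJung.CleanModels.Ccurve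

/-- **`stub_Cc_persistForm3` modulo the shared stub `stub_Cc_centreCurve` (S3)** — see the module docstring. [folklore] -/
theorem persistForm3_gen_of
    (hS3 :
    ∀ (k : Type) [Field k] (K : Type) [Field K] [Algebra k K]
    (O : ValuationSubring K) (A : Subalgebra k K), A.toSubring ≤ O.toSubring → A.FG → IsFractionRing A K → ringKrullDim A ≤ 3 →
    (∀ (T : Subring K) (hT : T ≤ O.toSubring), A.toSubring ≤ T → (subringCentre T O hT).IsMaximal) →
    ∀ (B : Subalgebra k K) (hBO : B.toSubring ≤ O.toSubring), A ≤ B → B.FG →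
    IsRegularLocalRing (locAtCentre B.toSubring O) → ringKrullDim (locAtCentre B.toSubring O) = 3 →
    ∀ (O₁ : ValuationSubring K), O ≤ O₁ → ringKrullDim (locAtCentre B.toSubring O₁) = 2 →
    ∃ (B' : Subalgebra k K) (hB'O : B'.toSubring ≤ O.toSubring), B ≤ B' ∧ B'.FG ∧
    IsRegularLocalRing (locAtCentre B'.toSubring O) ∧ ringKrullDim (locAtCentre B'.toSubring O) = 3 ∧
    locAtCentre B'.toSubring O₁ = locAtCentre B.toSubring O₁ ∧
    ∃ (x y z : K) (hx : x ∈ locAtCentre B'.toSubring O) (hy : y ∈ locAtCentre B'.toSubring O) (hz : z ∈ locAtCentre B'.toSubring O),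
      (haveI := isLocalRing_locAtCentre hB'O; IsLocalRing.maximalIdeal (locAtCentre B'.toSubring O)) =
        Ideal.span {⟨x, hx⟩, ⟨y, hy⟩, ⟨z, hz⟩} ∧
      ∀ w : ↥(locAtCentre B'.toSubring O), O₁.valuation (w : K) < 1 ↔ w ∈ Ideal.span {(⟨x, hx⟩ : ↥(locAtCentre B'.toSubring O)), ⟨y, hy⟩} )
    :
    ∀ (p : ℕ), p.Prime →
    ∀ (k : Type) [Field k] [CharP k p] (K : Type) [Field K] [Algebra k K]
    (O : ValuationSubring K) (A : Subalgebra k K), A.toSubring ≤ O.toSubring → A.FG → IsFractionRing A K →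
    ringKrullDim A ≤ 3 → IsRegularLocalRing (locAtCentre A.toSubring O) →
    ringKrullDim (locAtCentre A.toSubring O) = 3 →
    (∀ (T : Subring K) (hT : T ≤ O.toSubring), A.toSubring ≤ T → (subringCentre T O hT).IsMaximal) →
    ∀ g₀ : K, (∀ c : K, c ^ p ≠ g₀) →
    ¬ (∃ (O₁ : ValuationSubring K), O ≤ O₁ ∧ O₁ ≠ ⊤ ∧ ∃ y : Fin 2 → K, (∀ i, y i ∈ O) ∧
      ∀ P : MvPolynomial (Fin 2) k, P ≠ 0 → O₁.valuation (MvPolynomial.aeval y P) = 1) →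
    ∀ (O₁ : ValuationSubring K), O ≤ O₁ → O₁ ≠ O → O₁ ≠ ⊤ →
    ∀ (B : Subalgebra k K), B.toSubring ≤ O.toSubring → A ≤ B → B.FG →
    IsRegularLocalRing (locAtCentre B.toSubring O) → ringKrullDim (locAtCentre B.toSubring O) = 3 →
    ringKrullDim ↥(locAtCentre B.toSubring O₁) = 2 →
    ∀ (_ : IsRegularLocalRing ↥(locAtCentre B.toSubring O₁)) (c : Fin p → K), (∃ j : Fin p, (j : ℕ) ≠ 0 ∧ c j ≠ 0) →
    (∃ s c' : ↥(locAtCentre B.toSubring O₁), (∑ j : Fin p, c j ^ p * g₀ ^ (j : ℕ)) = (s : K) ∧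
    s - c' ^ p ∈ IsLocalRing.maximalIdeal ↥(locAtCentre B.toSubring O₁) ∧
    s - c' ^ p ∉ IsLocalRing.maximalIdeal ↥(locAtCentre B.toSubring O₁) ^ 2) →
    ∃ (A' : Subalgebra k K), A'.toSubring ≤ O.toSubring ∧ A ≤ A' ∧ A'.FG ∧
    ∃ (_ : IsRegularLocalRing ↥(locAtCentre A'.toSubring O)) (c : Fin p → K), (∃ j : Fin p, (j : ℕ) ≠ 0 ∧ c j ≠ 0) ∧
    ((∃ (d m : ℕ) (hmd : m ≤ d) (t : Fin d → ↥(locAtCentre A'.toSubring O)) (a : Fin m → ℕ) (u : ↥(locAtCentre A'.toSubring O)), IsUnit u ∧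
    Ideal.span (Set.range t) = IsLocalRing.maximalIdeal ↥(locAtCentre A'.toSubring O) ∧
    ringKrullDim ↥(locAtCentre A'.toSubring O) = (d : WithBot ℕ∞) ∧ 0 < m ∧ (∀ i, ¬ p ∣ a i) ∧
    (∑ j : Fin p, c j ^ p * g₀ ^ (j : ℕ)) = (u : K) * ∏ i : Fin m, ((t (Fin.castLE hmd i) : ↥(locAtCentre A'.toSubring O)) : K) ^ (a i)) ∨
    (∃ u : ↥(locAtCentre A'.toSubring O), IsUnit u ∧ (∑ j : Fin p, c j ^ p * g₀ ^ (j : ℕ)) = (u : K) ∧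
    ∀ c' : ↥(locAtCentre A'.toSubring O), u - c' ^ p ∉ IsLocalRing.maximalIdeal ↥(locAtCentre A'.toSubring O)) ∨
    (∃ s c' : ↥(locAtCentre A'.toSubring O), (∑ j : Fin p, c j ^ p * g₀ ^ (j : ℕ)) = (s : K) ∧
    s - c' ^ p ∈ IsLocalRing.maximalIdeal ↥(locAtCentre A'.toSubring O) ∧
    s - c' ^ p ∉ IsLocalRing.maximalIdeal ↥(locAtCentre A'.toSubring O) ^ 2)) := by
  intro p hp k _ _ K _ _ O A hAO hAfg hfrac hdimA hreg hdim3 hzd g₀ hg₀ hdiv O₁ hOO₁ hne hO₁ B hBO hAB hBfg hBreg hBdim hBdim₁ hreg₁ c hc h3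
  classical
  haveI : Fact p.Prime := ⟨hp⟩
  haveI := hfrac
  have hBO₁ : B.toSubring ≤ O₁.toSubring := fun w hw => hOO₁ (hBO hw)
  haveI := isLocalRing_locAtCentre hBO₁
  obtain ⟨s, c', hGs, hmem, hnot⟩ := h3
  -- S3: the centre curve made regular
  obtain ⟨B', hB'O, hBB', hB'fg, hB'reg, hB'dim, hloc₁, x, y, z, hx, hy, hz, hmax, hcen⟩ :=
    hS3 k K O A hAO hAfg hfrac hdimA hzd B hBO hAB hBfg hBreg hBdim O₁ hOO₁ hBdim₁
  haveI := isLocalRing_locAtCentre hB'O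
  haveI : IsRegularLocalRing ↥(locAtCentre B'.toSubring O) := hB'reg
  have hB'O₁ : B'.toSubring ≤ O₁.toSubring := fun w hw => hOO₁ (hB'O hw)
  haveI := isLocalRing_locAtCentre hB'O₁
  -- `τ = s - c'^p`, of `v₁`-value `< 1`, in `locAtCentre B' O₁ = locAtCentre B O₁`
  set τ : K := (s : K) - (c' : K) ^ p with hτ
  have hτ₁ : τ ∈ locAtCentre B.toSubring O₁ := (s - c' ^ p).2
  have hτ₁' : τ ∈ locAtCentre B'.toSubring O₁ := by rw [hloc₁]; exact hτ₁
  have hvτ : O₁.valuation τ < 1 := (mem_maximalIdeal_locAtCentre_iff hBO₁ (s - c' ^ p)).mp hmem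
  obtain ⟨α, β, γ, hα, hβ, hγ, hvγ, hτeq⟩ := exists_numerator_of_valuation_lt hx hy hcen hτ₁' hvτ
  have hγ0 : γ ≠ 0 := ne_zero_of_valuation_eq_one hvγ
  -- transversality from `τ ∉ 𝔪₁²`
  have ht : (x * α + y * β) / γ ∈ locAtCentre B'.toSubring O₁ := by rw [← hτeq]; exact hτ₁'
  have hnot' : (⟨_, ht⟩ : ↥(locAtCentre B'.toSubring O₁)) ∉ IsLocalRing.maximalIdeal ↥(locAtCentre B'.toSubring O₁) ^ 2 := by
    have ht₁ : (x * α + y * β) / γ ∈ locAtCentre B.toSubring O₁ := by rw [← hτeq]; exact hτ₁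
    rw [mem_sq_maximalIdeal_iff_of_eq hloc₁ ht ht₁]
    have : (⟨(x * α + y * β) / γ, ht₁⟩ : ↥(locAtCentre B.toSubring O₁)) = s - c' ^ p := by
      apply Subtype.ext
      change (x * α + y * β) / γ = ((s - c' ^ p : ↥(locAtCentre B.toSubring O₁)) : K)
      rw [← hτeq, hτ]; simp
    rw [this]; exact hnot
  have htr : O₁.valuation α = 1 ∨ O₁.valuation β = 1 :=
    transversal_of_not_mem_sq hB'O hOO₁ hx hy hcen hα hβ (le_locAtCentre _ _ hγ) hvγ ht hnot'
  -- the rescaled representative `γ^p τ = γ^(p-1) (x α + y β)`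
  haveI : CharP K p := charP_of_injective_algebraMap (algebraMap k K).injective p
  let c'' : Fin p → K := fun j => (if (j : ℕ) = 0 then c j - (c' : K) else c j) * γ
  have hc'' : ∃ j : Fin p, (j : ℕ) ≠ 0 ∧ c'' j ≠ 0 := by
    obtain ⟨j₀, hj₀, hcj₀⟩ := hc
    refine ⟨j₀, hj₀, ?_⟩
    simp only [c'', if_neg hj₀]
    exact mul_ne_zero hcj₀ hγ0
  have hsum₀ : (∑ j : Fin p, (if (j : ℕ) = 0 then c j - (c' : K) else c j) ^ p * g₀ ^ (j : ℕ)) = (s : K) - (c' : K) ^ p := by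
    have h0 : (⟨0, hp.pos⟩ : Fin p) ∈ (Finset.univ : Finset (Fin p)) := Finset.mem_univ _
    rw [← hGs, ← Finset.add_sum_erase _ _ h0, ← Finset.add_sum_erase _ (fun j => c j ^ p * g₀ ^ (j : ℕ)) h0]
    have hrest : ∑ j ∈ Finset.univ.erase (⟨0, hp.pos⟩ : Fin p), (if (j : ℕ) = 0 then c j - (c' : K) else c j) ^ p * g₀ ^ (j : ℕ) =
        ∑ j ∈ Finset.univ.erase (⟨0, hp.pos⟩ : Fin p), c j ^ p * g₀ ^ (j : ℕ) := by
      refine Finset.sum_congr rfl fun j hj => ?_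
      have hj0 : (j : ℕ) ≠ 0 := fun h => (Finset.ne_of_mem_erase hj) (Fin.ext h)
      simp only [if_neg hj0]
    rw [hrest]
    simp only [if_true, pow_zero, mul_one]
    rw [sub_pow_char (p := p) (c ⟨0, hp.pos⟩) (c' : K)]
    ring
  have hG'' : (∑ j : Fin p, c'' j ^ p * g₀ ^ (j : ℕ)) = γ ^ (p - 1) * (x * α + y * β) ^ 1 := by
    change (∑ j : Fin p, ((if (j : ℕ) = 0 then c j - (c' : K) else c j) * γ) ^ p * g₀ ^ (j : ℕ)) = _
    rw [sum_mul_pow_rescale, hsum₀, ← hτ, hτeq, pow_one]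
    obtain ⟨q, hq⟩ : ∃ q, p = q + 1 := ⟨p - 1, (Nat.sub_add_cancel hp.one_lt.le).symm⟩
    rw [hq, Nat.add_sub_cancel, pow_succ]
    field_simp
  have hA₀ : γ ^ (p - 1) ∈ locAtCentre B'.toSubring O := Subring.pow_mem _ (le_locAtCentre _ _ hγ) _
  have hvA₀ : O₁.valuation (γ ^ (p - 1)) = 1 := by rw [map_pow, hvγ, one_pow]
  have h1 : ¬ p ∣ 1 := fun h => hp.one_lt.ne' (Nat.dvd_one.mp h)
  exact persist_one_core p hp O A hAO hAfg hdimA hzd B' hB'O (hAB.trans hBB') hB'fg hB'reg hB'dim O₁ hOO₁ x y z hx hy hz hmax hcen g₀ c'' hc''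
    (γ ^ (p - 1)) α β hA₀ hvA₀ hα hβ htr 1 h1 hG''

end Summit.ResolutionOfSingularities.ResolutionOfSingularities.Theorems.RadicialJung.CleanModels.Ccurve

end
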